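import Summits.CriticalPhenomena.PercolationContinuityZ3.Theses.PercNearOneGluing
import Literature.Probability.Percolation.PercolationProofs
import Literature.Probability.Percolation.ConditionalPositiveAssociationProofs
import Literature.Probability.Percolation.TwoClusterConditionalAssociationProofs

/-! TTRL-lite variant V161 of stmt-CriticalPhenomena-4576 -/

namespace Summit.CriticalPhenomena.PercolationContinuityZ3.Theorems

open MeasureTheory Literature.Probability.LatticeModels Literature.Probability.Percolation
open scoped Classical BigOperators

/-- TTRL-lite variant V161 of the good-step statement of `stmt-CriticalPhenomena-4576`
(small case `n ≤ 3`, `A.card = 2`). The hypotheses force four pairwise distinct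
elements of `Fin n` (the two elements of `A`, `o`, and the witness `y`), which is
impossible for `n ≤ 3`, so the statement holds vacuously. -/
theorem cp4576_goodstep_var161 :
    ∀ (n : ℕ) (w : Sym2 (Fin n) → unitInterval) (A : Finset (Fin n)) (o b : Fin n), A.card = 2 → n ≤ 3 → b ∈ A → o ∉ A → (∃ y : Fin n, y ∉ A ∧ y ≠ o ∧ (w s(o, y) : ℝ) ≠ 0) → (∀ w' : Sym2 (Fin n) → unitInterval, (Finset.univ.filter (fun v : Fin n => ∃ u : Fin n, 0 < (w' s(u, v) : ℝ))).card < (Finset.univ.filter (fun v : Fin n => ∃ u : Fin n, 0 < (w s(u, v) : ℝ))).card → ∀ (A' : Finset (Fin n)) (o' b' : Fin n), b' ∈ A' → o' ∉ A' → ∀ (t : ℝ) (sel : Finset (Fin n) → Fin n), (∀ W, sel W ∈ A') → (∀ a ∈ A', 1 - t ≤ (prodBernoulli w').real (openConn a b')) → (prodBernoulli w').real ((⋃ a ∈ A', openConn o' a) ∩ (openConn o' b')ᶜ) + ∑ W ∈ (Finset.univ : Finset (Finset (Fin n))).filter (fun W => o' ∈ W ∧ Disjoint W A'), (prodBernoulli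 w').real {ω : BondConfig (Fin n) | openCluster ω o' = (W : Set (Fin n))} * (prodBernoulli w').real (openConnIn ((W : Set (Fin n))ᶜ) (sel W) b')ᶜ ≤ t) → ∀ (t : ℝ) (sel : Finset (Fin n) → Fin n), (∀ W, sel W ∈ A) → (∀ a ∈ A, 1 - t ≤ (prodBernoulli w).real (openConn a b)) → (prodBernoulli w).real ((⋃ a ∈ A, openConn o a) ∩ (openConn o b)ᶜ) + ∑ W ∈ (Finset.univ : Finset (Finset (Fin n))).filter (fun W => o ∈ W ∧ Disjoint W A), (prodBernoulli w).real {ω : BondConfig (Fin n) | openCluster ω o = (W : Set (Fin n))} * (prodBernoulli w).real (openConnIn ((W : Set (Fin n))ᶜ) (sel W) b)ᶜ ≤ t := by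
  intro n w A o b hA hn _ ho hy _ t sel _ _
  exfalso
  obtain ⟨y, hyA, hyo, _⟩ := hy
  have h1 : (insert y A).card = 3 := by
    rw [Finset.card_insert_of_notMem hyA, hA]
  have h2 : o ∉ insert y A := by
    intro h
    rcases Finset.mem_insert.mp h with h | h
    · exact hyo h.symm
    · exact ho h
  have h3 : (insert o (insert y A)).card = 4 := by
    rw [Finset.card_insert_of_notMem h2, h1]
  have h4 : (insert o (insert y A)).card ≤ n := by
    calc (insert o (insert y A)).card ≤ Fintype.card (Fin n) := Finset.card_le_univ _
      _ = n := Fintype.card_fin n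
  omega

end Summit.CriticalPhenomena.PercolationContinuityZ3.Theorems
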